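import Mathlib
import Summits.MatrixMultiplication.MatrixMultiplication.Theorems.SnSubsetDichotomyHyperoctahedralThresholdTwinSupplyCS

/-!
# Cauchy–Schwarz supply, part 2 of 3: word count and the cyclically reduced form

Helper for crux `SnSubsetDichotomy.HyperoctahedralThreshold` (stmt-MatrixMultiplication-10883), twins route;
continues `…TwinSupplyCS` (`act`, `RW`, `closedAt`, `supply`).

* `card_RW`: `|RW k| = 3·2^(k-1)` for `k ≥ 1` (fibres of `dropLast` have two elements).
* `supply_cyclic`: a closed reduced word at `x` that is not cyclically reduced is `c w c` with `w` closed
  and reduced at `x · c`, at most two letters `c` per `(x · c, w)`; hence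
  `|closedPairs (m+2)| ≤ |cycPairs (m+2)| + 2·|closedPairs m|`, and the supply inequality holds with
  CYCLICALLY reduced words — `|cycPairs μ m| = ∑_{z cyclically reduced, |z| = m} |Fix z|`, the `T_m` of the
  crux notes — with weight `(s+1)·2^s` and an additive `k·2^k·|α|`:
  `|RW k|² ≤ |α|·(|RW k| + k·2^k) + ∑_{s<k} (s+1)·2^s·|cycPairs μ (2(k-s))|`.
* `closedWalk_supply`, `closedWalk_supply_cyclic`, `stub_closedWalkSupplyCyclic` (registered form): the
  same on `Fin n` in the skeleton's vocabulary.
[crux research log `Cruxes/HyperoctahedralThreshold/NOTES.md` §12.3]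
-/

-- the tree's namespace `Summit.MatrixMultiplication.MatrixMultiplication.…` repeats a component by design
set_option linter.dupNamespace false

namespace Summit.MatrixMultiplication.MatrixMultiplication.Theorems.HyperoctahedralThreshold

namespace TwinSupplyCS

open Finset

variable {α : Type*}

/-- `RW 0 = {[]}`. -/
theorem RW_zero : RW 0 = {[]} := by
  ext g
  rw [mem_RW, mem_singleton, List.length_eq_zero_iff]
  constructor
  · exact fun h => h.1
  · rintro rfl; exact ⟨rfl, List.IsChain.nil⟩

/-- The fibre of `dropLast : RW (k+1) → RW k` over `a`: the words `a ++ [c]` with `c` different from the last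
letter of `a` (no condition when `a = []`). -/
theorem filter_dropLast_eq {k : ℕ} {a : List (Fin 3)} (ha : a ∈ RW k) :
    ((RW (k + 1)).filter fun g => g.dropLast = a) =
      ((univ : Finset (Fin 3)).filter fun c => ∀ d ∈ a.getLast?, d ≠ c).image fun c => a ++ [c] := by
  rw [mem_RW] at ha
  ext g
  simp only [mem_filter, mem_image, mem_univ, true_and, mem_RW]
  constructor
  · rintro ⟨⟨hgl, hgc⟩, hga⟩
    obtain ⟨c, hg, -⟩ := exists_eq_dropLast_append hgl
    rw [hga] at hg
    refine ⟨c, ?_, hg.symm⟩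
    rw [hg] at hgc
    intro d hd
    exact (List.isChain_append.mp hgc).2.2 d hd c (by simp)
  · rintro ⟨c, hc, rfl⟩
    refine ⟨⟨by simp [ha.1], ?_⟩, List.dropLast_concat⟩
    rw [List.isChain_append]
    refine ⟨ha.2, by simp, ?_⟩
    intro d hd y hy
    simp only [List.head?_cons, Option.mem_def, Option.some.injEq] at hy
    subst hy
    exact hc d hd

/-- Cardinality recursion for reduced words: `|RW (k+1)| = ∑_{a ∈ RW k} #{c : c ≠ last a}`. -/
theorem card_RW_succ (k : ℕ) :
    (RW (k + 1)).card =
      ∑ a ∈ RW k, ((univ : Finset (Fin 3)).filter fun c => ∀ d ∈ a.getLast?, d ≠ c).card := by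
  have hmaps : Set.MapsTo (fun g : List (Fin 3) => g.dropLast) (RW (k + 1) : Set (List (Fin 3)))
      (RW k : Set (List (Fin 3))) := by
    intro g hg
    rw [mem_coe, mem_RW] at hg ⊢
    obtain ⟨c, hg', -⟩ := exists_eq_dropLast_append hg.1
    refine ⟨by simp [List.length_dropLast, hg.1], ?_⟩
    have hgc := hg.2
    rw [hg'] at hgc
    exact (List.isChain_append.mp hgc).1
  rw [card_eq_sum_card_fiberwise hmaps]
  refine sum_congr rfl fun a ha => ?_
  rw [filter_dropLast_eq ha, card_image_of_injective]
  intro c c' h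
  simpa using List.append_cancel_left h

/-- `|RW k| = 3 · 2^(k-1)` for `k ≥ 1`. -/
theorem card_RW {k : ℕ} (hk : 1 ≤ k) : (RW k).card = 3 * 2 ^ (k - 1) := by
  induction k with
  | zero => omega
  | succ k ih =>
    rcases Nat.eq_zero_or_pos k with rfl | hk'
    · -- `k + 1 = 1`: three one-letter words
      rw [card_RW_succ, RW_zero, sum_singleton]
      simp
    · rw [card_RW_succ]
      have h2 : ∀ a ∈ RW k, ((univ : Finset (Fin 3)).filter fun c => ∀ d ∈ a.getLast?, d ≠ c).card = 2 := by
        intro a ha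
        rw [mem_RW] at ha
        have hne : a ≠ [] := by rintro rfl; simp at ha; omega
        have : ((univ : Finset (Fin 3)).filter fun c => ∀ d ∈ a.getLast?, d ≠ c) =
            (univ : Finset (Fin 3)).erase (a.getLast hne) := by
          ext c
          simp [List.getLast?_eq_some_getLast hne, eq_comm]
        rw [this, card_erase_of_mem (mem_univ _)]
        simp
      rw [sum_congr rfl h2, sum_const, smul_eq_mul, ih hk']
      obtain ⟨j, rfl⟩ : ∃ j, k = j + 1 := ⟨k - 1, by omega⟩
      simp [pow_succ]
      ring

/-- Reindexing a triangular double sum: `∑_{i<k} ∑_{t<k-i} f(i+t) = ∑_{s<k} (s+1)·f(s)`. -/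
theorem sum_range_sum_range_sub (k : ℕ) (f : ℕ → ℕ) :
    ∑ i ∈ range k, ∑ t ∈ range (k - i), f (i + t) = ∑ s ∈ range k, (s + 1) * f s := by
  induction k with
  | zero => simp
  | succ k ih =>
    rw [sum_range_succ, sum_range_succ, ← ih, Nat.add_sub_cancel_left, sum_range_one, add_zero]
    have : ∀ i ∈ range k, ∑ t ∈ range (k + 1 - i), f (i + t) =
        ∑ t ∈ range (k - i), f (i + t) + f k := by
      intro i hi
      rw [mem_range] at hi
      rw [show k + 1 - i = (k - i) + 1 by omega, sum_range_succ, Nat.add_sub_cancel' hi.le]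
    rw [sum_congr rfl this, sum_add_distrib, sum_const, card_range, smul_eq_mul]
    ring

section Dec
variable [DecidableEq α]

/-- Based closed reduced walks of length `m`, as pairs `(x, v)`. -/
def closedPairs [Fintype α] (μ : Fin 3 → Equiv.Perm α) (m : ℕ) : Finset (α × List (Fin 3)) :=
  ((univ : Finset α) ×ˢ RW m).filter fun xv => act μ xv.1 xv.2 = xv.1

/-- Based closed CYCLICALLY reduced walks of length `m`: pairs `(x, z)` with `z` cyclically reduced
(`List.IsChain (· ≠ ·) (z ++ z)`, the skeleton's convention) of length `m` and `x · z = x`, i.e. `x ∈ Fix z`. -/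
def cycPairs [Fintype α] (μ : Fin 3 → Equiv.Perm α) (m : ℕ) : Finset (α × List (Fin 3)) :=
  (closedPairs μ m).filter fun xv => List.IsChain (· ≠ ·) (xv.2 ++ xv.2)

/-- Membership in `closedPairs`. -/
theorem mem_closedPairs [Fintype α] {μ : Fin 3 → Equiv.Perm α} {m : ℕ} {x : α} {v : List (Fin 3)} :
    (x, v) ∈ closedPairs μ m ↔ (v.length = m ∧ List.IsChain (· ≠ ·) v) ∧ act μ x v = x := by
  simp [closedPairs, mem_RW]

/-- Every point is fixed by the empty word: `|closedPairs μ 0| = |α|`. -/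
theorem card_closedPairs_zero [Fintype α] (μ : Fin 3 → Equiv.Perm α) :
    (closedPairs μ 0).card = Fintype.card α := by
  have : closedPairs μ 0 = (univ : Finset α) ×ˢ ({[]} : Finset (List (Fin 3))) := by
    ext ⟨x, v⟩
    rw [mem_closedPairs, mem_product, mem_singleton, List.length_eq_zero_iff]
    constructor
    · rintro ⟨⟨rfl, -⟩, -⟩; exact ⟨mem_univ _, rfl⟩
    · rintro ⟨-, rfl⟩; exact ⟨⟨rfl, List.IsChain.nil⟩, rfl⟩
  rw [this, card_product, card_singleton, mul_one, card_univ]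

/-- A closed reduced word that is NOT cyclically reduced is `c :: (w ++ [c])` with `w` closed at `x · c`:
these number at most twice the closed reduced words two letters shorter. -/
theorem card_notCyc_le [Fintype α] (μ : Fin 3 → Equiv.Perm α) (hμ : ∀ c, Function.Involutive (μ c))
    (m : ℕ) :
    ((closedPairs μ (m + 2)).filter fun xv => ¬ List.IsChain (· ≠ ·) (xv.2 ++ xv.2)).card ≤
      2 * (closedPairs μ m).card := by
  set A := (closedPairs μ (m + 2)).filter fun xv => ¬ List.IsChain (· ≠ ·) (xv.2 ++ xv.2) with hA
  set f : α × List (Fin 3) → α × List (Fin 3) :=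
    fun xv => (μ (xv.2.headD 0) xv.1, xv.2.tail.dropLast) with hf
  -- structure of an element of `A`: `v = c :: (w ++ [c])`, `w` reduced of length `m`, closed at `μ c x`
  have memA : ∀ {x : α} {v : List (Fin 3)}, (x, v) ∈ A →
      ∃ c w, v = c :: (w ++ [c]) ∧ (w.length = m ∧ List.IsChain (· ≠ ·) w) ∧
        act μ (μ c x) w = μ c x ∧ List.IsChain (· ≠ ·) v := by
    intro x v h
    rw [hA, mem_filter, mem_closedPairs] at h
    obtain ⟨⟨⟨hvl, hvc⟩, hfix⟩, hncyc⟩ := h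
    obtain ⟨c, u, rfl⟩ : ∃ c u, v = c :: u := by
      cases v with
      | nil => simp at hvl
      | cons c u => exact ⟨c, u, rfl⟩
    have hul : u.length = m + 1 := by simpa using hvl
    obtain ⟨d, hu, huL⟩ := exists_eq_dropLast_append hul
    set w := u.dropLast with hw
    -- the wrap letter: `d = c`
    have hdc : d = c := by
      by_contra hne
      apply hncyc
      rw [List.isChain_append]
      refine ⟨hvc, hvc, ?_⟩
      intro a ha b hb
      simp only [List.head?_cons, Option.mem_def, Option.some.injEq] at hb
      rw [List.getLast?_cons_of_ne_nil (by rw [hu]; simp), huL, Option.mem_def, Option.some.injEq] at ha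
      rw [← ha, ← hb]
      exact hne
    subst hdc
    refine ⟨d, w, by rw [← hu], ⟨by simp [hw, List.length_dropLast, hul], ?_⟩, ?_, hvc⟩
    · have h1 : List.IsChain (· ≠ ·) u := hvc.tail
      rw [hu] at h1
      exact (List.isChain_append.mp h1).1
    · have h2 : act μ x (d :: u) = act μ (μ d x) u := by simp [act]
      rw [h2, hu, act_append, act_singleton] at hfix
      have := congrArg (μ d) hfix
      rwa [hμ d] at this
  -- (1) image inside the shorter closed pairs
  have himg : A.image f ⊆ closedPairs μ m := by
    intro b hb
    obtain ⟨⟨x, v⟩, hxv, rfl⟩ := mem_image.mp hb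
    obtain ⟨c, w, rfl, hw, hfix, -⟩ := memA hxv
    simp only [hf, List.headD_cons, List.tail_cons, List.dropLast_concat]
    exact mem_closedPairs.mpr ⟨hw, hfix⟩
  -- (2) fibres have at most two elements
  have hfib : ∀ b ∈ A.image f, (A.filter fun xv => f xv = b).card ≤ 2 := by
    rintro ⟨y, w⟩ -
    by_cases hw0 : w = []
    · have : (A.filter fun xv => f xv = (y, w)) = ∅ := by
        ext ⟨x, v⟩
        simp only [mem_filter, notMem_empty, iff_false, not_and]
        intro hxv hfv
        obtain ⟨c, w', rfl, -, -, hvc⟩ := memA hxv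
        simp only [hf, List.headD_cons, List.tail_cons, List.dropLast_concat, Prod.mk.injEq] at hfv
        rw [hfv.2, hw0] at hvc
        simp at hvc
      rw [this, card_empty]; exact Nat.zero_le _
    · have hsub : (A.filter fun xv => f xv = (y, w)) ⊆
          ((univ : Finset (Fin 3)).erase (w.head hw0)).image fun c => (μ c y, c :: (w ++ [c])) := by
        rintro ⟨x, v⟩ hxv
        rw [mem_filter] at hxv
        obtain ⟨hxv, hfv⟩ := hxv
        obtain ⟨c, w', rfl, -, -, hvc⟩ := memA hxv
        simp only [hf, List.headD_cons, List.tail_cons, List.dropLast_concat, Prod.mk.injEq] at hfv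
        obtain ⟨hy, rfl⟩ := hfv
        refine mem_image.mpr ⟨c, ?_, ?_⟩
        · rw [mem_erase]
          refine ⟨?_, mem_univ _⟩
          obtain ⟨e, w'', hw'⟩ : ∃ e w'', w' = e :: w'' := by
            cases w' with
            | nil => exact absurd rfl hw0
            | cons e w'' => exact ⟨e, w'', rfl⟩
          subst hw'
          simp only [List.cons_append, List.isChain_cons_cons] at hvc
          simpa using hvc.1
        · simp only [Prod.mk.injEq, and_true]
          rw [← hy, hμ c]
      calc (A.filter fun xv => f xv = (y, w)).card
          ≤ (((univ : Finset (Fin 3)).erase (w.head hw0)).image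
              fun c => (μ c y, c :: (w ++ [c]))).card := card_le_card hsub
        _ ≤ ((univ : Finset (Fin 3)).erase (w.head hw0)).card := card_image_le
        _ = 2 := by rw [card_erase_of_mem (mem_univ _)]; simp
  calc A.card ≤ 2 * (A.image f).card := card_le_mul_card_image A 2 hfib
    _ ≤ 2 * (closedPairs μ m).card := Nat.mul_le_mul_left 2 (card_le_card himg)

/-- Two-step recursion: `|closedPairs (m+2)| ≤ |cycPairs (m+2)| + 2·|closedPairs m|`. -/
theorem card_closedPairs_add_two_le [Fintype α] (μ : Fin 3 → Equiv.Perm α)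
    (hμ : ∀ c, Function.Involutive (μ c)) (m : ℕ) :
    (closedPairs μ (m + 2)).card ≤ (cycPairs μ (m + 2)).card + 2 * (closedPairs μ m).card := by
  rw [← card_filter_add_card_filter_not (s := closedPairs μ (m + 2))
    (fun xv : α × List (Fin 3) => List.IsChain (· ≠ ·) (xv.2 ++ xv.2))]
  exact Nat.add_le_add_left (card_notCyc_le μ hμ m) _

/-- Unrolled at even lengths: `|closedPairs (2j)| ≤ ∑_{t<j} 2^t |cycPairs (2(j-t))| + 2^j |α|`. -/
theorem card_closedPairs_even_le [Fintype α] (μ : Fin 3 → Equiv.Perm α)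
    (hμ : ∀ c, Function.Involutive (μ c)) (j : ℕ) :
    (closedPairs μ (2 * j)).card ≤
      ∑ t ∈ range j, 2 ^ t * (cycPairs μ (2 * (j - t))).card + 2 ^ j * Fintype.card α := by
  induction j with
  | zero => simp [card_closedPairs_zero]
  | succ j ih =>
    calc (closedPairs μ (2 * (j + 1))).card
        ≤ (cycPairs μ (2 * (j + 1))).card + 2 * (closedPairs μ (2 * j)).card :=
          card_closedPairs_add_two_le μ hμ (2 * j)
      _ ≤ (cycPairs μ (2 * (j + 1))).card +
            2 * (∑ t ∈ range j, 2 ^ t * (cycPairs μ (2 * (j - t))).card + 2 ^ j * Fintype.card α) := by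
          gcongr
      _ = ∑ t ∈ range (j + 1), 2 ^ t * (cycPairs μ (2 * (j + 1 - t))).card +
            2 ^ (j + 1) * Fintype.card α := by
          rw [sum_range_succ']
          have hsum : ∑ t ∈ range j, 2 ^ (t + 1) * (cycPairs μ (2 * (j + 1 - (t + 1)))).card =
              2 * ∑ t ∈ range j, 2 ^ t * (cycPairs μ (2 * (j - t))).card := by
            rw [mul_sum]
            refine sum_congr rfl fun t _ => ?_
            rw [Nat.add_sub_add_right, pow_succ]
            ring
          rw [hsum]
          simp only [Nat.sub_zero, pow_zero, one_mul, pow_succ]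
          ring

/-- **Supply with cyclically reduced words.**  For three involutions of a nonempty finite set `α` and every
`k`:  `|RW k|² ≤ |α|·(|RW k| + k·2^k) + ∑_{s<k} (s+1)·2^s · |cycPairs μ (2(k-s))|`, where
`|cycPairs μ m| = ∑_{z cyclically reduced, |z| = m} |Fix z|`. -/
theorem supply_cyclic [Fintype α] [Nonempty α] (μ : Fin 3 → Equiv.Perm α)
    (hμ : ∀ c, Function.Involutive (μ c)) (k : ℕ) :
    (RW k).card ^ 2 ≤ Fintype.card α * ((RW k).card + k * 2 ^ k) +
      ∑ s ∈ range k, (s + 1) * 2 ^ s * (cycPairs μ (2 * (k - s))).card := by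
  have h := supply μ hμ k
  have hstep : ∀ i ∈ range k, 2 ^ i * ∑ x : α, (closedAt μ (2 * (k - i)) x).card ≤
      2 ^ k * Fintype.card α +
        ∑ t ∈ range (k - i), 2 ^ i * (2 ^ t * (cycPairs μ (2 * (k - i - t))).card) := by
    intro i hi
    rw [mem_range] at hi
    rw [sum_card_closedAt]
    calc 2 ^ i * (closedPairs μ (2 * (k - i))).card
        ≤ 2 ^ i * (∑ t ∈ range (k - i), 2 ^ t * (cycPairs μ (2 * (k - i - t))).card +
            2 ^ (k - i) * Fintype.card α) :=
          Nat.mul_le_mul_left _ (card_closedPairs_even_le μ hμ (k - i))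
      _ = 2 ^ k * Fintype.card α +
            ∑ t ∈ range (k - i), 2 ^ i * (2 ^ t * (cycPairs μ (2 * (k - i - t))).card) := by
          rw [mul_add, mul_sum, ← mul_assoc, ← pow_add, Nat.add_sub_cancel' hi.le, add_comm]
  calc (RW k).card ^ 2
      ≤ Fintype.card α * (RW k).card +
          ∑ i ∈ range k, 2 ^ i * ∑ x : α, (closedAt μ (2 * (k - i)) x).card := h
    _ ≤ Fintype.card α * (RW k).card + ∑ i ∈ range k, (2 ^ k * Fintype.card α +
          ∑ t ∈ range (k - i), 2 ^ i * (2 ^ t * (cycPairs μ (2 * (k - i - t))).card)) :=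
        Nat.add_le_add_left (sum_le_sum hstep) _
    _ = Fintype.card α * ((RW k).card + k * 2 ^ k) +
          ∑ s ∈ range k, (s + 1) * 2 ^ s * (cycPairs μ (2 * (k - s))).card := by
        rw [sum_add_distrib, sum_const, card_range, smul_eq_mul]
        have hre := sum_range_sum_range_sub k (fun s => 2 ^ s * (cycPairs μ (2 * (k - s))).card)
        have : ∀ i ∈ range k, ∑ t ∈ range (k - i), 2 ^ i * (2 ^ t * (cycPairs μ (2 * (k - i - t))).card) =
            ∑ t ∈ range (k - i), (fun s => 2 ^ s * (cycPairs μ (2 * (k - s))).card) (i + t) := by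
          intro i _
          refine sum_congr rfl fun t _ => ?_
          simp only [pow_add, Nat.sub_sub, mul_assoc]
        rw [sum_congr rfl this, hre]
        simp only [mul_assoc]
        ring

end Dec

/-! ### On `Fin n` -/

/-- Cyclically reduced words of length `m` in the tree's vocabulary. -/
theorem filter_RW_eq_vector (m : ℕ) : (RW m).filter (fun z => List.IsChain (· ≠ ·) (z ++ z)) =
    ((univ : Finset (List.Vector (Fin 3) m)).image (fun v => v.toList)).filter
      (fun z => List.IsChain (· ≠ ·) (z ++ z)) := by
  ext z
  simp only [mem_RW, mem_filter, mem_image, mem_univ, true_and]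
  constructor
  · rintro ⟨⟨hl, -⟩, hc⟩
    exact ⟨⟨⟨z, hl⟩, rfl⟩, hc⟩
  · rintro ⟨⟨v, rfl⟩, hc⟩
    exact ⟨⟨v.toList_length, (List.isChain_append.mp hc).1⟩, hc⟩

/-- **Closed-walk supply on `Fin n`.**  For three involutions of `Fin n` (`n ≥ 1`) and `k ≥ 1`:
`(3·2^(k-1))² ≤ n · 3·2^(k-1) + ∑_{i<k} 2^i · #{(x, v) : v reduced of length 2(k-i), x·v = x}`. -/
theorem closedWalk_supply (n k : ℕ) (hn : 1 ≤ n) (hk : 1 ≤ k) (μ : Fin 3 → Equiv.Perm (Fin n))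
    (hμ : ∀ c, μ c * μ c = 1) :
    (3 * 2 ^ (k - 1)) ^ 2 ≤ n * (3 * 2 ^ (k - 1)) + ∑ i ∈ range k, 2 ^ i *
      (((univ : Finset (Fin n)) ×ˢ RW (2 * (k - i))).filter
        fun xv => xv.2.foldl (fun v c => μ c v) xv.1 = xv.1).card := by
  haveI : Nonempty (Fin n) := ⟨⟨0, hn⟩⟩
  have h := supply μ (involutive_of_mul_self μ hμ) k
  rw [card_RW hk, Fintype.card_fin] at h
  refine h.trans (Nat.add_le_add_left (le_of_eq ?_) _)
  refine sum_congr rfl fun i _ => ?_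
  rw [sum_card_closedAt]
  rfl

/-- **Closed-walk supply on `Fin n`, cyclically reduced form.**  For three involutions of `Fin n` (`n ≥ 1`)
and `k ≥ 1`, with `T_m := #{(x, z) : z cyclically reduced of length m, x · z = x} = ∑_{|z| = m} |Fix z|`:
`(3·2^(k-1))² ≤ n · (3·2^(k-1) + k·2^k) + ∑_{s<k} (s+1)·2^s · T_{2(k-s)}`. -/
theorem closedWalk_supply_cyclic (n k : ℕ) (hn : 1 ≤ n) (hk : 1 ≤ k) (μ : Fin 3 → Equiv.Perm (Fin n))
    (hμ : ∀ c, μ c * μ c = 1) :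
    (3 * 2 ^ (k - 1)) ^ 2 ≤ n * (3 * 2 ^ (k - 1) + k * 2 ^ k) + ∑ s ∈ range k, (s + 1) * 2 ^ s *
      (((univ : Finset (Fin n)) ×ˢ RW (2 * (k - s))).filter
        fun xz => List.IsChain (· ≠ ·) (xz.2 ++ xz.2) ∧ xz.2.foldl (fun v c => μ c v) xz.1 = xz.1).card := by
  haveI : Nonempty (Fin n) := ⟨⟨0, hn⟩⟩
  have h := supply_cyclic μ (involutive_of_mul_self μ hμ) k
  rw [card_RW hk, Fintype.card_fin] at h
  refine h.trans (Nat.add_le_add_left (le_of_eq ?_) _)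
  refine sum_congr rfl fun s _ => ?_
  congr 1
  apply congrArg Finset.card
  ext ⟨x, z⟩
  simp only [cycPairs, closedPairs, mem_filter, mem_product, mem_univ, true_and, act]
  tauto

/-- **`stub_closedWalkSupplyCyclic`** (registered sub-goal of stmt-MatrixMultiplication-10883): the closed-walk
supply on `Fin n` in cyclically reduced form, `T_m = #{(x, z) : z cyclically reduced, |z| = m, x·z = x}`:
`(3·2^(k-1))² ≤ n·(3·2^(k-1) + k·2^k) + ∑_{s<k} (s+1)·2^s·T_{2(k-s)}`. -/
theorem stub_closedWalkSupplyCyclic : ∀ (n k : ℕ) (μ : Fin 3 → Equiv.Perm (Fin n)), (∀ c, μ c * μ c = 1) → 1 ≤ n → 1 ≤ k → (3 * 2 ^ (k - 1)) ^ 2 ≤ n * (3 * 2 ^ (k - 1) + k * 2 ^ k) + ∑ s ∈ Finset.range k, (s + 1) * 2 ^ s * (((Finset.univ : Finset (Fin n)) ×ˢ (((Finset.univ : Finset (List.Vector (Fin 3) (2 * (k - s)))).image (fun v => v.toList)).filter (fun z => List.IsChain (· ≠ ·) (z ++ z)))).filter (fun p => p.2.foldl (fun v c => μ c v) p.1 =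 p.1)).card := by
  intro n k μ hμ hn hk
  refine (closedWalk_supply_cyclic n k hn hk μ hμ).trans (Nat.add_le_add_left (le_of_eq ?_) _)
  refine sum_congr rfl fun s _ => ?_
  congr 1
  rw [← filter_RW_eq_vector]
  apply congrArg Finset.card
  ext ⟨x, z⟩
  simp only [mem_filter, mem_product, mem_univ, true_and]
  tauto
end TwinSupplyCS

end Summit.MatrixMultiplication.MatrixMultiplication.Theorems.HyperoctahedralThreshold
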